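import Mathlib.Algebra.Field.Rat
import Mathlib.Tactic.Ring
import Mathlib.Tactic.LinearCombination
import HarnessLib

/-!
# Two-prime old-space exactness: the FULL complex, the SIGNED complex, and Ihara on new quotients (cell `b2b-bsdres`, seat additive-p4 gen 33, line V56 — bridges for the typed target T-V54)

HONEST FRAMING (verbatim, cell `b2b-bsdres`): the goal of the cell is to DELETE the COMBINATION-SHAPED
residual classes for ALL analytic-rank `≤ 1` curves over `ℚ` — "full BSD formula for every rank `≤ 1`
curve in class `C`" assembled STRICTLY from published theorems — so that the rank-`≤ 1` remainder
becomes exactly the CONSTRUCTION-SHAPED classes, which are TYPED (missing-input Props), NOT attempted;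
this is not "finishing BSD". This file: TOOL theorems (pure algebra of functions `ℚ → R`), 0 defs,
0 facts, nothing booked; X4 CONSTRUCTION-SHAPED; no mark moves.

## Why

The additive certificate of gens 31–32 (`X4/KuriharaAdditiveCertificateOfExactness.lean`,
`…TwistOfExactness.lean`, `…OfCycles.lean`) takes ONE structural input that is not a published theorem:
the hypothesis `hexact` — exactness in the middle of the SIGNED three-term complex
`P₀ → P₁ × P₂ → (ℚ → R)`, `z ↦ ((1 − w₂[c₂]) z, −(1 − w₁[c₁]) z)`, `(g, h) ↦ (1 − w₁[c₁]) g + (1 − w₂[c₂]) h`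
(`[c]` = precomposition with `r ↦ c r`; levels `N/c₁c₂ → N/c₁, N/c₂ → N`). The typed target T-V54
("two-prime Ihara exactness at a non-Eisenstein maximal ideal", memo V54 §2) is naturally stated for
the FULL old-space complex `Z⁴ → Y₁² ⊕ Y₂² → X` (both degeneracy copies at each prime), which is the
row `E¹_{•,1}` of the equivariant (co)homology spectral sequence of `Γ₀(N/c₁c₂; ℤ[1/c₁c₂])` on the
product of two Bruhat–Tits trees, and in the literature's language it is an IHARA statement for NEW
QUOTIENTS (the shape of Ribet's exact sequence of character groups). This file proves the three
elementary bridges, so that each published or censused form of the statement feeds `hexact` by name: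

* `signedExact_of_fullExact` — FULL middle-exactness + the two-copy (bottom-row, one-prime) injectivity
  `z + z'∘[c₂] = 0 ⇒ z = z' = 0` on `P₀` ⟹ the SIGNED `hexact` for every pair of signs `(w₁, w₂)`.
* `signedExact_of_newQuotient` — "Ihara at `c₁` on the `c₂`-new quotients"
  (`(1 − w₁[c₁]) g ∈ (1 − w₂[c₂]) P₂ ⇒ g ∈ (1 − w₂[c₂]) P₀` for `g ∈ P₁`) + injectivity of `1 − w₂[c₂]`
  on `P₂` ⟹ `hexact`.
* `newQuotient_of_signedExact` — the converse direction (so the two forms are equivalent on groups).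

All sets are only assumed closed under the operations actually used (stated as hypotheses), so the
lemmas apply verbatim to the path-function sets of `X4/PathFunctionOfFunctional.lean`.

## References (context only; the proofs here are elementary)

* K. Ribet, Invent. Math. 100 (1990) 431–476, Thm. 4.1 (the exact sequence of character groups
  `0 → X(C, q) → X(J₀(Mpq), p) → X(J₀(Mp), p)² → 0` — the toric shadow of the middle row). [cite: Ribet1990, Thm. 4.1]
* K. Ribet, Proc. ICM 1983 (1984), Thm. 4.1 (Ihara's lemma, one prime). [cite: Ribet1984ICM, Thm. 4.1]
* F. Diamond, R. Taylor, Invent. Math. 115 (1994), Thm. 2 (injectivity of the `2^r` old copies). [cite: DiamondTaylor1994, Thm. 2]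
-/

namespace Summit.BirchSwinnertonDyer.Rank1Residual.LevelLowering

section Bridges

variable {R : Type*} [CommRing R]

/-- **SIGNED EXACTNESS FROM FULL EXACTNESS.** Sets `P₁, P₂, P₀ ⊆ (ℚ → R)`; `P₁` (resp. `P₂`) closed
under `g ↦ −w₁ g` (resp. `h ↦ −w₂ h`), `P₀` closed under `(z, z') ↦ z + w z'`. FULL middle-exactness:
every `(g, g', h, h') ∈ P₁² × P₂²` with `g + g'∘[c₁] + h + h'∘[c₂] = 0` is
`(z₁ + z₂∘[c₂], z₃ + z₄∘[c₂], −(z₁ + z₃∘[c₁]), −(z₂ + z₄∘[c₁]))` with `zᵢ ∈ P₀`. Bottom-row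
injectivity (one prime each): `z + z'∘[c₂] = 0 ⇒ z = z' = 0` and `z + z'∘[c₁] = 0 ⇒ z = 0` on `P₀`.
THEN the signed complex is exact in the middle: `(1 − w₁[c₁]) g + (1 − w₂[c₂]) h = 0` forces
`g = (1 − w₂[c₂]) z`, `h = −(1 − w₁[c₁]) z` for some `z ∈ P₀` — the hypothesis `hexact` of
`plusSymbolLevelLowersAdditivelyModAt_of_exact` / `…_of_ratTwist_of_exact`.
[cite: DiamondTaylor1994, Thm. 2] [cite: Ribet1984ICM, Thm. 4.1] -/
theorem signedExact_of_fullExact {P₁ P₂ P₀ : Set (ℚ → R)} (w₁ w₂ : R) {c₁ c₂ : ℕ}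
    (hs₁ : ∀ g ∈ P₁, (fun r ↦ -(w₁ * g r)) ∈ P₁)
    (hs₂ : ∀ h ∈ P₂, (fun r ↦ -(w₂ * h r)) ∈ P₂)
    (hlin₀ : ∀ z ∈ P₀, ∀ z' ∈ P₀, ∀ w : R, (fun r ↦ z r + w * z' r) ∈ P₀)
    (hfull : ∀ g ∈ P₁, ∀ g' ∈ P₁, ∀ h ∈ P₂, ∀ h' ∈ P₂,
      (∀ r : ℚ, g r + g' (c₁ * r) + (h r + h' (c₂ * r)) = 0) →
      ∃ z₁ ∈ P₀, ∃ z₂ ∈ P₀, ∃ z₃ ∈ P₀, ∃ z₄ ∈ P₀,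
        (g = fun r ↦ z₁ r + z₂ (c₂ * r)) ∧ (g' = fun r ↦ z₃ r + z₄ (c₂ * r)) ∧
        (h = fun r ↦ -(z₁ r + z₃ (c₁ * r))) ∧ (h' = fun r ↦ -(z₂ r + z₄ (c₁ * r))))
    (hinj₁ : ∀ z ∈ P₀, ∀ z' ∈ P₀, (∀ r : ℚ, z r + z' (c₂ * r) = 0) →
      (z = fun _ ↦ 0) ∧ (z' = fun _ ↦ 0))
    (hinj₂ : ∀ z ∈ P₀, ∀ z' ∈ P₀, (∀ r : ℚ, z r + z' (c₁ * r) = 0) → z = fun _ ↦ 0) :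
    ∀ g ∈ P₁, ∀ h ∈ P₂, (∀ r : ℚ, (g r - w₁ * g (c₁ * r)) + (h r - w₂ * h (c₂ * r)) = 0) →
      ∃ z ∈ P₀, (g = fun r ↦ z r - w₂ * z (c₂ * r)) ∧ (h = fun r ↦ -(z r - w₁ * z (c₁ * r))) := by
  intro g hg h hh hrel
  obtain ⟨z₁, hz₁, z₂, hz₂, z₃, hz₃, z₄, hz₄, hgz, hg'z, hhz, hh'z⟩ :=
    hfull g hg _ (hs₁ g hg) h hh _ (hs₂ h hh) (fun r ↦ by
      have := hrel r
      linear_combination this)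
  -- from `g' = −w₁ g`: `(z₃ + w₁ z₁) + (z₄ + w₁ z₂)∘[c₂] = 0`, so `z₃ = −w₁ z₁`, `z₄ = −w₁ z₂`
  have h34 : ∀ r : ℚ, (z₃ r + w₁ * z₁ r) + (z₄ (c₂ * r) + w₁ * z₂ (c₂ * r)) = 0 := by
    intro r
    have h1 := congrFun hg'z r
    have h2 := congrFun hgz r
    linear_combination -h1 - w₁ * h2
  obtain ⟨h3, -⟩ := hinj₁ _ (hlin₀ z₃ hz₃ z₁ hz₁ w₁) _ (hlin₀ z₄ hz₄ z₂ hz₂ w₁)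
    (fun r ↦ by simpa using h34 r)
  -- from `h' = −w₂ h`: `(z₂ + w₂ z₁) + (z₄ + w₂ z₃)∘[c₁] = 0`, so `z₂ = −w₂ z₁`
  have h24 : ∀ r : ℚ, (z₂ r + w₂ * z₁ r) + (z₄ (c₁ * r) + w₂ * z₃ (c₁ * r)) = 0 := by
    intro r
    have h1 := congrFun hh'z r
    have h2 := congrFun hhz r
    linear_combination h1 + w₂ * h2
  have h2 := hinj₂ _ (hlin₀ z₂ hz₂ z₁ hz₁ w₂) _ (hlin₀ z₄ hz₄ z₃ hz₃ w₂)
    (fun r ↦ by simpa using h24 r)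
  have e3 : ∀ r, z₃ r = -(w₁ * z₁ r) := fun r ↦ by
    have := congrFun h3 r; linear_combination this
  have e2 : ∀ r, z₂ r = -(w₂ * z₁ r) := fun r ↦ by
    have := congrFun h2 r; linear_combination this
  refine ⟨z₁, hz₁, ?_, ?_⟩
  · funext r
    have := congrFun hgz r
    rw [this, e2]
    ring
  · funext r
    have := congrFun hhz r
    rw [this, e3]
    ring

/-- **SIGNED EXACTNESS FROM IHARA ON THE NEW QUOTIENTS.** The literature-shaped form of T-V54: for
`g ∈ P₁`, if `(1 − w₁[c₁]) g` is `c₂`-old-SHAPED at level `N` (`= (1 − w₂[c₂]) h`, `h ∈ P₂`), then `g` is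
already `c₂`-old-shaped at level `N/c₁` (`= (1 − w₂[c₂]) z`, `z ∈ P₀`) — injectivity of `1 − w₁[c₁]`
on the `c₂`-NEW QUOTIENTS `P₁/(1 − w₂[c₂])P₀ → (ℚ → R)/(1 − w₂[c₂])P₂`. Together with the one-prime
injectivity of `1 − w₂[c₂]` on `P₂` (Ihara) and closure of `P₂` under `h ↦ −h` and
`h ↦ h + (1 − w₁[c₁]) z` (`z ∈ P₀`), it gives the signed `hexact`.
[cite: Ribet1990, Thm. 4.1] [cite: Ribet1984ICM, Thm. 4.1] -/
theorem signedExact_of_newQuotient {P₁ P₂ P₀ : Set (ℚ → R)} (w₁ w₂ : R) {c₁ c₂ : ℕ}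
    (hneg₂ : ∀ h ∈ P₂, (fun r ↦ -h r) ∈ P₂)
    (hadd₂ : ∀ h ∈ P₂, ∀ z ∈ P₀, (fun r ↦ h r + (z r - w₁ * z (c₁ * r))) ∈ P₂)
    (hinj₂ : ∀ h ∈ P₂, (∀ r : ℚ, h r - w₂ * h (c₂ * r) = 0) → h = fun _ ↦ 0)
    (hnew : ∀ g ∈ P₁, (∃ h ∈ P₂, ∀ r : ℚ, g r - w₁ * g (c₁ * r) = h r - w₂ * h (c₂ * r)) →
      ∃ z ∈ P₀, g = fun r ↦ z r - w₂ * z (c₂ * r)) :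
    ∀ g ∈ P₁, ∀ h ∈ P₂, (∀ r : ℚ, (g r - w₁ * g (c₁ * r)) + (h r - w₂ * h (c₂ * r)) = 0) →
      ∃ z ∈ P₀, (g = fun r ↦ z r - w₂ * z (c₂ * r)) ∧ (h = fun r ↦ -(z r - w₁ * z (c₁ * r))) := by
  intro g hg h hh hrel
  obtain ⟨z, hz, hgz⟩ := hnew g hg ⟨_, hneg₂ h hh, fun r ↦ by
    have := hrel r
    linear_combination this⟩
  refine ⟨z, hz, hgz, ?_⟩
  -- `h' := h + (1 − w₁[c₁]) z ∈ P₂` is killed by `1 − w₂[c₂]`, hence zero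
  have hk : (fun r ↦ h r + (z r - w₁ * z (c₁ * r))) = fun _ ↦ 0 := by
    refine hinj₂ _ (hadd₂ h hh z hz) fun r ↦ ?_
    have h0 := hrel r
    have h1 := congrFun hgz r
    have h2 := congrFun hgz (c₁ * r)
    have hc : (c₂ : ℚ) * (c₁ * r) = c₁ * (c₂ * r) := by ring
    rw [hc] at h2
    rw [h1, h2] at h0
    linear_combination h0
  funext r
  have := congrFun hk r
  linear_combination this

/-- **THE CONVERSE: IHARA ON THE NEW QUOTIENTS FROM SIGNED EXACTNESS** (`P₂` closed under `h ↦ −h`).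
So on groups the two formulations of T-V54's signed form are equivalent. [cite: Ribet1990, Thm. 4.1] -/
theorem newQuotient_of_signedExact {P₁ P₂ P₀ : Set (ℚ → R)} (w₁ w₂ : R) {c₁ c₂ : ℕ}
    (hneg₂ : ∀ h ∈ P₂, (fun r ↦ -h r) ∈ P₂)
    (hexact : ∀ g ∈ P₁, ∀ h ∈ P₂,
      (∀ r : ℚ, (g r - w₁ * g (c₁ * r)) + (h r - w₂ * h (c₂ * r)) = 0) →
      ∃ z ∈ P₀, (g = fun r ↦ z r - w₂ * z (c₂ * r)) ∧ (h = fun r ↦ -(z r - w₁ * z (c₁ * r)))) :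
    ∀ g ∈ P₁, (∃ h ∈ P₂, ∀ r : ℚ, g r - w₁ * g (c₁ * r) = h r - w₂ * h (c₂ * r)) →
      ∃ z ∈ P₀, g = fun r ↦ z r - w₂ * z (c₂ * r) := by
  rintro g hg ⟨h, hh, hgh⟩
  obtain ⟨z, hz, hgz, -⟩ := hexact g hg _ (hneg₂ h hh) fun r ↦ by
    have := hgh r
    linear_combination this
  exact ⟨z, hz, hgz⟩

/-- **UNSIGNED SPECIALISATION** (`w₁ = w₂ = 1`, the shape of `hexact` in
`plusSymbolLevelLowersAdditivelyModAt_of_exact`): FULL middle-exactness + bottom-row injectivity ⟹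
`hexact`. [cite: DiamondTaylor1994, Thm. 2] -/
theorem exact_of_fullExact {P₁ P₂ P₀ : Set (ℚ → R)} {c₁ c₂ : ℕ}
    (hs₁ : ∀ g ∈ P₁, (fun r ↦ -g r) ∈ P₁) (hs₂ : ∀ h ∈ P₂, (fun r ↦ -h r) ∈ P₂)
    (hlin₀ : ∀ z ∈ P₀, ∀ z' ∈ P₀, ∀ w : R, (fun r ↦ z r + w * z' r) ∈ P₀)
    (hfull : ∀ g ∈ P₁, ∀ g' ∈ P₁, ∀ h ∈ P₂, ∀ h' ∈ P₂,
      (∀ r : ℚ, g r + g' (c₁ * r) + (h r + h' (c₂ * r)) = 0) →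
      ∃ z₁ ∈ P₀, ∃ z₂ ∈ P₀, ∃ z₃ ∈ P₀, ∃ z₄ ∈ P₀,
        (g = fun r ↦ z₁ r + z₂ (c₂ * r)) ∧ (g' = fun r ↦ z₃ r + z₄ (c₂ * r)) ∧
        (h = fun r ↦ -(z₁ r + z₃ (c₁ * r))) ∧ (h' = fun r ↦ -(z₂ r + z₄ (c₁ * r))))
    (hinj₁ : ∀ z ∈ P₀, ∀ z' ∈ P₀, (∀ r : ℚ, z r + z' (c₂ * r) = 0) →
      (z = fun _ ↦ 0) ∧ (z' = fun _ ↦ 0))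
    (hinj₂ : ∀ z ∈ P₀, ∀ z' ∈ P₀, (∀ r : ℚ, z r + z' (c₁ * r) = 0) → z = fun _ ↦ 0) :
    ∀ g ∈ P₁, ∀ h ∈ P₂, (∀ r : ℚ, (g r - g (c₁ * r)) + (h r - h (c₂ * r)) = 0) →
      ∃ z ∈ P₀, (g = fun r ↦ z r - z (c₂ * r)) ∧ (h = fun r ↦ -(z r - z (c₁ * r))) := by
  intro g hg h hh hrel
  obtain ⟨z, hz, h1, h2⟩ := signedExact_of_fullExact (P₁ := P₁) (P₂ := P₂) (P₀ := P₀) 1 1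
    (c₁ := c₁) (c₂ := c₂) (fun g hg ↦ by simpa using hs₁ g hg) (fun h hh ↦ by simpa using hs₂ h hh)
    hlin₀ hfull hinj₁ hinj₂ g hg h hh (fun r ↦ by simpa using hrel r)
  exact ⟨z, hz, by simpa using h1, by simpa using h2⟩


/-! ### §2 The sub-partition: FULL exactness is AUTOMATIC off the doubly-level-raising locus

If the maximal ideal is not level-raising at one of the two primes, the corresponding
intermediate level carries no new forms there (Ribet's converse to level raising), so one of the
two middle sets is entirely OLD from `P₀`; then the FULL middle exactness follows from ONE-PRIME
two-copy injectivity (Ihara) alone — no two-prime input. Hence the typed target T-V54 has content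
only at maximal ideals that are level-raising at BOTH primes (the locus audited by instrument
E12b); the additive certificate's rows all lie there (defect primes). -/

/-- **CASE B (first prime idle): FULL EXACTNESS FROM ONE-PRIME DATA.** If every `h ∈ P₂` (level
`N/c₂ = M₀c₁`) is `c₁`-OLD from `P₀` (`h = z + z'∘[c₁]`; i.e. no `c₁`-new forms at the maximal ideal
at level `M₀c₁` — automatic when it is not level-raising at `c₁`), `P₁` is closed under adding
`c₂`-old functions from `P₀`, `P₀` under negation, and the two `c₁`-degeneracy copies of `P₁` are
jointly injective at level `N` (Ihara at `c₁`), then the FULL complex is exact in the middle (the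
hypothesis `hfull` of `signedExact_of_fullExact`). [cite: Ribet1984ICM, Thm. 4.1] [cite: Ribet1990, Thm. 4.1] -/
theorem fullExact_of_oldAtFirst {P₁ P₂ P₀ : Set (ℚ → R)} {c₁ c₂ : ℕ}
    (hold₂ : ∀ h ∈ P₂, ∃ z ∈ P₀, ∃ z' ∈ P₀, h = fun r ↦ z r + z' (c₁ * r))
    (hadd₁ : ∀ g ∈ P₁, ∀ z ∈ P₀, ∀ z' ∈ P₀, (fun r ↦ g r + (z r + z' (c₂ * r))) ∈ P₁)
    (hneg₀ : ∀ z ∈ P₀, (fun r ↦ -z r) ∈ P₀)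
    (hinj : ∀ G ∈ P₁, ∀ G' ∈ P₁, (∀ r : ℚ, G r + G' (c₁ * r) = 0) →
      (G = fun _ ↦ 0) ∧ (G' = fun _ ↦ 0)) :
    ∀ g ∈ P₁, ∀ g' ∈ P₁, ∀ h ∈ P₂, ∀ h' ∈ P₂,
      (∀ r : ℚ, g r + g' (c₁ * r) + (h r + h' (c₂ * r)) = 0) →
      ∃ z₁ ∈ P₀, ∃ z₂ ∈ P₀, ∃ z₃ ∈ P₀, ∃ z₄ ∈ P₀,
        (g = fun r ↦ z₁ r + z₂ (c₂ * r)) ∧ (g' = fun r ↦ z₃ r + z₄ (c₂ * r)) ∧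
        (h = fun r ↦ -(z₁ r + z₃ (c₁ * r))) ∧ (h' = fun r ↦ -(z₂ r + z₄ (c₁ * r))) := by
  intro g hg g' hg' h hh h' hh' hrel
  obtain ⟨z₁, hz₁, z₃, hz₃, hhz⟩ := hold₂ h hh
  obtain ⟨z₂, hz₂, z₄, hz₄, hh'z⟩ := hold₂ h' hh'
  -- `G := g + z₁ + z₂∘[c₂]`, `G' := g' + z₃ + z₄∘[c₂]` satisfy `G + G'∘[c₁] = 0`
  obtain ⟨hG, hG'⟩ := hinj _ (hadd₁ g hg z₁ hz₁ z₂ hz₂) _ (hadd₁ g' hg' z₃ hz₃ z₄ hz₄) (fun r ↦ by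
    have h0 := hrel r
    have h1 := congrFun hhz r
    have h2 := congrFun hh'z (c₂ * r)
    have hc : (c₁ : ℚ) * (c₂ * r) = c₂ * (c₁ * r) := by ring
    rw [hc] at h2
    rw [h1, h2] at h0
    linear_combination h0)
  refine ⟨_, hneg₀ z₁ hz₁, _, hneg₀ z₂ hz₂, _, hneg₀ z₃ hz₃, _, hneg₀ z₄ hz₄, ?_, ?_, ?_, ?_⟩
  · funext r; have := congrFun hG r; linear_combination this
  · funext r; have := congrFun hG' r; linear_combination this
  · funext r; have := congrFun hhz r; linear_combination this
  · funext r; have := congrFun hh'z r; linear_combination this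

/-- **CASE B (second prime idle), the mirror statement.** If every `g ∈ P₁` (level `N/c₁ = M₀c₂`) is
`c₂`-OLD from `P₀`, `P₂` is closed under adding `c₁`-old functions from `P₀`, and the two
`c₂`-degeneracy copies of `P₂` are jointly injective at level `N` (Ihara at `c₂`), then the FULL
complex is exact in the middle. [cite: Ribet1984ICM, Thm. 4.1] [cite: Ribet1990, Thm. 4.1] -/
theorem fullExact_of_oldAtSecond {P₁ P₂ P₀ : Set (ℚ → R)} {c₁ c₂ : ℕ}
    (hold₁ : ∀ g ∈ P₁, ∃ z ∈ P₀, ∃ z' ∈ P₀, g = fun r ↦ z r + z' (c₂ * r))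
    (hadd₂ : ∀ h ∈ P₂, ∀ z ∈ P₀, ∀ z' ∈ P₀, (fun r ↦ h r + (z r + z' (c₁ * r))) ∈ P₂)
    (hinj : ∀ H ∈ P₂, ∀ H' ∈ P₂, (∀ r : ℚ, H r + H' (c₂ * r) = 0) →
      (H = fun _ ↦ 0) ∧ (H' = fun _ ↦ 0)) :
    ∀ g ∈ P₁, ∀ g' ∈ P₁, ∀ h ∈ P₂, ∀ h' ∈ P₂,
      (∀ r : ℚ, g r + g' (c₁ * r) + (h r + h' (c₂ * r)) = 0) →
      ∃ z₁ ∈ P₀, ∃ z₂ ∈ P₀, ∃ z₃ ∈ P₀, ∃ z₄ ∈ P₀,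
        (g = fun r ↦ z₁ r + z₂ (c₂ * r)) ∧ (g' = fun r ↦ z₃ r + z₄ (c₂ * r)) ∧
        (h = fun r ↦ -(z₁ r + z₃ (c₁ * r))) ∧ (h' = fun r ↦ -(z₂ r + z₄ (c₁ * r))) := by
  intro g hg g' hg' h hh h' hh' hrel
  obtain ⟨z₁, hz₁, z₂, hz₂, hgz⟩ := hold₁ g hg
  obtain ⟨z₃, hz₃, z₄, hz₄, hg'z⟩ := hold₁ g' hg'
  -- `H := h + z₁ + z₃∘[c₁]`, `H' := h' + z₂ + z₄∘[c₁]` satisfy `H + H'∘[c₂] = 0`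
  obtain ⟨hH, hH'⟩ := hinj _ (hadd₂ h hh z₁ hz₁ z₃ hz₃) _ (hadd₂ h' hh' z₂ hz₂ z₄ hz₄) (fun r ↦ by
    have h0 := hrel r
    have h1 := congrFun hgz r
    have h2 := congrFun hg'z (c₁ * r)
    have hc : (c₂ : ℚ) * (c₁ * r) = c₁ * (c₂ * r) := by ring
    rw [hc] at h2
    rw [h1, h2] at h0
    linear_combination h0)
  refine ⟨z₁, hz₁, z₂, hz₂, z₃, hz₃, z₄, hz₄, hgz, hg'z, ?_, ?_⟩
  · funext r; have := congrFun hH r; linear_combination this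
  · funext r; have := congrFun hH' r; linear_combination this

end Bridges

end Summit.BirchSwinnertonDyer.Rank1Residual.LevelLowering
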